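import Literature.AlgebraicGeometry.Resolution.EChart
import Literature.AlgebraicGeometry.Resolution.DChartRoof
import HarnessLib

/-!
# The E-chart with extra members by integrality

Topic: `Literature/AlgebraicGeometry/Resolution` (valued function fields). The `m°`-half of the
common smooth roof in the algebraic proof of M. Temkin, *Inseparable local uniformization*,
J. Algebra 373 (2013) = arXiv:0804.1554v3, Thm. 3.3.1 (tree: `Temkin2013RelativeCurveSmoothFibre`),
in the form consumed by the level-wise construction (`DESIGN-J2-v2`): `EChart.exists_EChart`
produces a smooth, integrally closed `m°`-subalgebra `T ⊆ O_V` of `Ω` containing the disc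
coordinate `x′`, the Hensel root `η` and every element `z` with a prepared normal form
`a_z(η)/(b_z(η) g(η)ᵏ)`. The `K`-side witnesses of the construction (separating unit, Newton
quotients, coefficients of minimal polynomials, …) have no prepared normal form; they are put into
`T` by INTEGRALITY instead: `T` is integrally closed, so an element `g` of its fraction field
(`w g ∈ m°[x′, η]` for some `w ∈ m°[x′] ∖ 0`) which is a root of a monic polynomial with
coefficients in the polynomial chart `B = m°[x′][1/u]` lies in `T` — the coefficients themselves
being members of `T` through the trivial normal form `b = (C b)(η)/(1 · g(η)⁰)`.

* `exists_EChart_with_members` — **the E-chart containing, besides `x′`, `η` and `Z`, a finite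
  set `G` of elements given with a monic equation over `B` and a fraction form over `m°[x′, η]`**
  — PROVED (`exists_EChart` with `Z` enlarged by the coefficients, then
  `mem_of_isIntegral_of_mul_mem` of `DChartRoof.lean`).

All statements are [folklore] given the cited results; no definitions, no named facts.

## Sources

* M. Temkin, arXiv:0804.1554v3, proof of Thm. 3.3.1, Steps 2–4 (pp. 44–45).
* H. Knaf, F.-V. Kuhlmann, Adv. Math. 221 (2009), Lemma 3.7 and Thm. 3.8, through the tree.
-/

noncomputable section

open Polynomial

namespace Literature.AlgebraicGeometry.Resolution

universe u

variable {Ω : Type u} [Field Ω]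

/-- The coefficients of a constant polynomial lie in any subalgebra containing the constant.
[folklore] -/
theorem coeff_C_mem_subalgebra {R : Type u} [CommRing R] [Algebra R Ω] (S : Subalgebra R Ω)
    {b : Ω} (hb : b ∈ S) (j : ℕ) : (C b : Polynomial Ω).coeff j ∈ S := by
  rw [coeff_C]
  split_ifs
  · exact hb
  · exact S.zero_mem

/-- The coefficients of the polynomial `1` lie in any subalgebra. [folklore] -/
theorem coeff_one_mem_subalgebra {R : Type u} [CommRing R] [Algebra R Ω] (S : Subalgebra R Ω)
    (j : ℕ) : (1 : Polynomial Ω).coeff j ∈ S := by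
  rw [coeff_one]
  split_ifs
  · exact S.one_mem
  · exact S.zero_mem

/-- A root of a monic polynomial over `Ω` whose coefficients lie in a subalgebra `T` is integral
over `T`. [folklore] -/
theorem isIntegral_subalgebra_of_monic_of_coeff_mem {R : Type u} [CommRing R] [Algebra R Ω]
    (T : Subalgebra R Ω) {q : Polynomial Ω} (hqm : q.Monic) (hq : ∀ k, q.coeff k ∈ T) {g : Ω}
    (hg : q.eval g = 0) : IsIntegral T g := by
  have hl : q ∈ Polynomial.lifts (algebraMap T Ω) := by
    refine (Polynomial.lifts_iff_coeff_lifts _).mpr fun i => ?_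
    exact ⟨⟨q.coeff i, hq i⟩, rfl⟩
  obtain ⟨qT, hqT, -, hqTmon⟩ := Polynomial.lifts_and_degree_eq_and_monic hl hqm
  refine ⟨qT, hqTmon, ?_⟩
  rw [← Polynomial.eval_map, hqT]
  exact hg

section EChart

variable (V : ValuationSubring Ω) (m : Subfield Ω)

set_option maxHeartbeats 800000 in
/-- **The E-chart with extra members by integrality.** The hypotheses are those of
`exists_EChart` (centre `a₀, c₀ ∈ m`, `x′ = (x − a₀)/c₀` transcendental over `m° = O_V ∩ m`, the
unit-form product `u`, standard-étale data `η, f, g, h, p₂, s` with coefficients in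
`B = m°[x′][1/u]`, `f` minimal, `f′h + f p₂ = gˢ`, `|g(η)| = 1`, and `Z` with normal forms) together
with a finite set `G` each of whose elements is a root of a MONIC polynomial over `Ω` with
coefficients in `B` and has a fraction form `w·g ∈ m°[x′, η]`, `w ∈ m°[x′] ∖ 0`. Conclusion: the
conclusion of `exists_EChart`, and moreover `G ⊆ T`. [folklore] -/
theorem exists_EChart_with_members {x a₀ c₀ : Ω} (hxaV : V.valuation (x - a₀) ≤ V.valuation c₀)
    (htr : Transcendental (V.toSubring ⊓ m.toSubring : Subring Ω) ((x - a₀) / c₀))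
    {u : Ω} (hu : u ∈ Algebra.adjoin (V.toSubring ⊓ m.toSubring : Subring Ω) ({(x - a₀) / c₀} : Set Ω))
    (hvu : V.valuation u = 1)
    {η : Ω} (hηV : η ∈ V) (f g h p₂ : Polynomial Ω) (s : ℕ) (hfmon : f.Monic) (hfη : f.eval η = 0)
    (hcoef : ∀ Q ∈ ({f, g, h, p₂} : Set (Polynomial Ω)), ∀ k,
      Q.coeff k ∈ locAway (Algebra.adjoin (V.toSubring ⊓ m.toSubring : Subring Ω)
        ({(x - a₀) / c₀} : Set Ω)) u hu)
    (hfmin : ∀ Q : Polynomial Ω, (∀ k, Q.coeff k ∈ Subfield.closure ((m : Set Ω) ∪ {x})) → Q ≠ 0 →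
      Q.eval η = 0 → f.natDegree ≤ Q.natDegree)
    (hident : derivative f * h + f * p₂ = g ^ s) (hvg : V.valuation (g.eval η) = 1)
    (ha₀ : a₀ ∈ m) (hc₀ : c₀ ∈ m)
    (Z : Finset Ω) (hZ : ∀ z ∈ Z, ∃ (az bz : Polynomial Ω) (k : ℕ),
      (∀ j, az.coeff j ∈ locAway (Algebra.adjoin (V.toSubring ⊓ m.toSubring : Subring Ω)
          ({(x - a₀) / c₀} : Set Ω)) u hu ∧
        bz.coeff j ∈ locAway (Algebra.adjoin (V.toSubring ⊓ m.toSubring : Subring Ω)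
          ({(x - a₀) / c₀} : Set Ω)) u hu) ∧
      V.valuation (bz.eval η) = 1 ∧ z = az.eval η / (bz.eval η * g.eval η ^ k))
    (G : Finset Ω) (hG : ∀ g' ∈ G,
      (∃ q : Polynomial Ω, q.Monic ∧
        (∀ k, q.coeff k ∈ locAway (Algebra.adjoin (V.toSubring ⊓ m.toSubring : Subring Ω)
          ({(x - a₀) / c₀} : Set Ω)) u hu) ∧ q.eval g' = 0) ∧
      ∃ w ∈ Algebra.adjoin (V.toSubring ⊓ m.toSubring : Subring Ω) ({(x - a₀) / c₀} : Set Ω),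
        w ≠ 0 ∧ w * g' ∈ Algebra.adjoin (V.toSubring ⊓ m.toSubring : Subring Ω)
          ({(x - a₀) / c₀, η} : Set Ω)) :
    ∃ (T : Subalgebra (V.toSubring ⊓ m.toSubring : Subring Ω) Ω),
      Algebra.Smooth (V.toSubring ⊓ m.toSubring : Subring Ω) T ∧ IsIntegrallyClosed T ∧
      T.toSubring ≤ V.toSubring ∧ (x - a₀) / c₀ ∈ T ∧ η ∈ T ∧ (∀ z ∈ Z, z ∈ T) ∧
      (∀ g' ∈ G, g' ∈ T) ∧
      ∃ D ∈ Algebra.adjoin (V.toSubring ⊓ m.toSubring : Subring Ω) ({(x - a₀) / c₀, η} : Set Ω),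
        V.valuation D = 1 ∧ ∀ w ∈ T, ∃ N : ℕ,
        w * D ^ N ∈ Algebra.adjoin (V.toSubring ⊓ m.toSubring : Subring Ω)
          ({(x - a₀) / c₀, η} : Set Ω) := by
  classical
  set Om : Subring Ω := V.toSubring ⊓ m.toSubring with hOm
  set x' : Ω := (x - a₀) / c₀ with hx'
  set B := locAway (Algebra.adjoin Om ({x'} : Set Ω)) u hu with hB
  -- the monic equations of the members of `G`
  have hq : ∀ g' : G, ∃ q : Polynomial Ω, q.Monic ∧ (∀ k, q.coeff k ∈ B) ∧ q.eval (g' : Ω) = 0 :=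
    fun g' => (hG g' g'.2).1
  choose q hqm hqB hqg using hq
  -- enlarge `Z` by their coefficients
  let Zc : Finset Ω := Finset.univ.biUnion fun g' : G =>
    (Finset.range ((q g').natDegree + 1)).image fun k => (q g').coeff k
  have hZc : ∀ b ∈ Zc, b ∈ B := by
    intro b hb
    obtain ⟨g', -, hb⟩ := Finset.mem_biUnion.mp hb
    obtain ⟨k, -, rfl⟩ := Finset.mem_image.mp hb
    exact hqB g' k
  have hgη0 : g.eval η ≠ 0 := fun h0 => by
    rw [h0, map_zero] at hvg
    exact zero_ne_one hvg
  have hZ' : ∀ z ∈ Z ∪ Zc, ∃ (az bz : Polynomial Ω) (k : ℕ),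
      (∀ j, az.coeff j ∈ B ∧ bz.coeff j ∈ B) ∧
      V.valuation (bz.eval η) = 1 ∧ z = az.eval η / (bz.eval η * g.eval η ^ k) := by
    intro z hz
    rcases Finset.mem_union.mp hz with hz | hz
    · exact hZ z hz
    · refine ⟨C z, 1, 0, fun j => ⟨coeff_C_mem_subalgebra B (hZc z hz) j,
        coeff_one_mem_subalgebra B j⟩, ?_, ?_⟩
      · rw [eval_one, map_one]
      · rw [eval_C, eval_one, pow_zero, mul_one, div_one]
  obtain ⟨T, hsm, hic, hTV, hx'T, hηT, hZT, D, hD, hvD, hexp⟩ :=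
    exists_EChart V m hxaV htr hu hvu hηV f g h p₂ s hfmon hfη hcoef hfmin hident hvg ha₀ hc₀
      (Z ∪ Zc) hZ'
  refine ⟨T, hsm, hic, hTV, hx'T, hηT, fun z hz => hZT z (Finset.mem_union_left _ hz),
    fun g' hg' => ?_, D, hD, hvD, hexp⟩
  -- `g' ∈ T` by integrality and the fraction form
  haveI := hic
  have hadj1 : Algebra.adjoin Om ({x'} : Set Ω) ≤ T :=
    Algebra.adjoin_le (Set.singleton_subset_iff.mpr hx'T)
  have hadj2 : Algebra.adjoin Om ({x', η} : Set Ω) ≤ T := by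
    refine Algebra.adjoin_le ?_
    rintro y (rfl | rfl)
    · exact hx'T
    · exact hηT
  have hcoefT : ∀ k, (q ⟨g', hg'⟩).coeff k ∈ T := by
    intro k
    by_cases hk : k ≤ (q ⟨g', hg'⟩).natDegree
    · refine hZT _ (Finset.mem_union_right _ (Finset.mem_biUnion.mpr ⟨⟨g', hg'⟩, Finset.mem_univ _, ?_⟩))
      exact Finset.mem_image.mpr ⟨k, Finset.mem_range.mpr (Nat.lt_succ_of_le hk), rfl⟩
    · rw [coeff_eq_zero_of_natDegree_lt (not_le.mp hk)]
      exact T.zero_mem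
  have hint : IsIntegral T g' :=
    isIntegral_subalgebra_of_monic_of_coeff_mem T (hqm ⟨g', hg'⟩) hcoefT (hqg ⟨g', hg'⟩)
  obtain ⟨w, hw, hw0, hwg⟩ := (hG g' hg').2
  exact mem_of_isIntegral_of_mul_mem T hint (hadj1 hw) hw0 (hadj2 hwg)

end EChart

end Literature.AlgebraicGeometry.Resolution

end
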